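/-
Copyright (c) 2026 the pub-hodgecm-mathlib formalisation cell (harness21).  Prover seat hodgecm-mathlib-K2Liu-p25 (g3), Track B «K2-LIT»,
#184♮ = hLiu418 = `stmt-HodgeConjecture-24832`; #42S BLOCK D, row D-2, the support dichotomy `hΨ` of ★ W1-fin ∕ ★ p863462 ∕ ★ p863521
(chair K2-lead (g2) VALVE 2026-09-05T00:19:37Z; block-D desk K2Liu-p12 (g5) WORDS #1–#2; audit1 HOLE-CHECK 2026-09-04T23:41:57Z).
THEOREMS ONLY (no `def`, no `instance`, no `notation`, no named-fact hypothesis, no `sorry`, default heartbeats).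
-/
import Literature.NumberTheory.GelbartRogawski1991.LocalDoubledSiegelUnipotentAnisotropy   -- ★ `dotProduct_cOfFix_mover_conj_eq_im`, `nElem (τ • 1)`, movers
import Literature.NumberTheory.Automorphic.LocalHermitianPlaneCongruence                 -- ★ `exists_hermForm_self_eq_one` (binary hermitian forms represent `1`, non-split `v`)
import Literature.NumberTheory.Automorphic.LocalPiSchwartzBruhatFourier                   -- ★ `indicator_vadd_piPrimePowBall_mem_schwartzBruhat` (test vectors)
import Literature.NumberTheory.QuadraticForms.HasseMinkowskiTernaryLemmas                -- ★ `hilbertSymbol_eq_one_iff_exists_norm` (O'Meara 63:10)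
import Literature.NumberTheory.QuadraticForms.HilbertReciprocityFiniteness              -- ★ `hilbertSymbol_mul_sq_right` (square classes)
import Literature.NumberTheory.Automorphic.QuadraticHeckeCharacterCM                      -- ★ `cmQuadraticGenerator_spec` (the dead-place test's `θ`)
import Literature.NumberTheory.GelbartRogawski1991.UnitaryDualPairThetaKernelCM            -- ★ `imagUnit`, `imagUnitSq` (the apparatus' `δ`, `δ²`)
import HarnessLib

-- buildfix G11b-3 recipe (LEDGER B13-1/B13-3), as in the GelbartRogawski1991 siblings: elaborate sequentially.
set_option Elab.async false

/-!
# Crux `HLiu418`, #42S BLOCK D, row D-2: THE RAO PHASE FORM OF THE SCALAR SIEGEL UNIPOTENT IS `(im τ) · h_{𝕋₀}` — universal at rank `2 + 2`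
# (so ★ W1-fin's support dichotomy `hΨ` is NOT a consequence of deadness there), a binary NORM form at rank `1 + 1` (so `hΨ` is Ψ-FREE there)

Cell `hodgecm-mathlib`, crux item hLiu418 = `stmt-HodgeConjecture-24832` (helper lane `--supports … --as helper`, count-neutral; closes no socket); squad K2 ∕ K2Liu
(L1).  Prover K2Liu-p25 (g3); desk K2Liu-p12 (g5) ∕ K2E5-p16 (g8); box K2Liu-audit1 (g2).  ★ W1-fin `K2LiuRankOneLocalSWWhittakerVanishing` (and through it the D-2
`hV` wiring ★ p863165 ∕ p863405 ∕ p863462 ∕ p863521) takes BY VALUE `hΨ : ∀ y ∈ tsupport (Γ Ψ), halfForm (cOfFix 𝕋 (E″ · ι(n(τ·1)) · E″⁻¹)) y ≠ β′` for the Rao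
parameter of the scalar Siegel unipotent `n(τ · 1)` (★ `nElem`, `skew_smul_one`) of `U(V ⊕ −V)(F_v)`, `V = T₀ ⊗ 1` of rank `n`, in the Schrödinger model `𝒮(F_v^{n+n})`.
* §1 (any rank `n`, any `E′ ∈ Sp(𝕎_v)`): **`halfForm (c ·) x = im τ · re h_{𝕋₀}(b, b)`**, `b = halfDiff (eD⁻¹ (E′⁻¹ (x, 0))) ∈ (E ⊗ F_v)^n` (`halfForm_cOfFix_mover_conj_nElem_eq`,
  ★ `dotProduct_cOfFix_mover_conj_eq_im` halved); for a mover (`E′ ℓ_Δ = ℓ_Y`) `x ↦ b` is ONTO (`exists_halfDiff_eq`), so every `im τ · re h_{𝕋₀}(b₀, b₀)` is a value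
  of the phase form (`exists_halfForm_cOfFix_mover_conj_nElem_eq_of_hermForm`).
* §2 (rank `2`, the datum of record of ★ W1-fin-b ∕ ★ W1-fin §2: `kronLoc … v 2`, `gramD F 2 T₀`, `𝒮(F_v^{2+2})`; `v` NON-SPLIT): the phase form is UNIVERSAL —
  **`∀ β′, ∃ x, halfForm (c ·) x = β′`** (`exists_halfForm_cOfFix_mover_conj_nElem_eq`; §1 + Jacobson's «binary hermitian forms over `E_v` represent `1`»,
  ★ `exists_hermForm_self_eq_one`, at `β″⁻¹ · 𝕋₀`), so for EVERY `β′` and implementer `Γ` SOME test vector violates the dichotomy (`exists_testVector_not_supportDichotomy`,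
  `Ψ = Γ⁻¹ 1_{y₀ + 𝒪_v^{2+2}}`).  RECORDED NEGATIVE: at rank `2 + 2` the letter `hΨ` is a support condition on the constructor's `Ψ`, never a consequence of «`v` dead».
* §3 (rank `1`: `T₀ = (a)`, `U(⟨a⟩ ⊕ ⟨−a⟩)`, `𝒮(F_v^{1+1})` — the complementary LINE of [KudlaRallis1994, §2]): **`halfForm (c ·) x = im τ · a · (re b₀² − d · im b₀²)`**
  (`halfForm_cOfFix_mover_conj_nElem_eq_norm_one`), whence the Ψ-FREE dichotomy `halfForm_cOfFix_mover_conj_nElem_ne_of_not_norm` (`β′ ≠ 0`, `β′·(a·im τ)⁻¹ ≠ r² − d s²`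
  ⟹ `∀ x, halfForm (c ·) x ≠ β′`) and its Hilbert-symbol dress `halfForm_cOfFix_mover_conj_nElem_ne_of_hilbertSymbol` (`(β′·(a·im τ)⁻¹, d)_v = −1`; O'Meara 63:10,
  ★ `hilbertSymbol_eq_one_iff_exists_norm`) — the `hΨ` letter a `(1+1)` edition of ★ W1-fin §2 consumes FOR EVERY `Ψ`.
* §4 CM readings (`L` CM, `δ = imagUnit L`, `d = δ² = imagUnitSq L`): `…_cm`, the square-class bridge `δ² = θ · r²` to the dead-place test's `θ = cmQuadraticGenerator L`
  (`hilbertSymbol_imagUnitSq_eq_cmQuadraticGenerator`) and the dichotomy in that currency (`…_ne_of_hilbertSymbol_cmQuadraticGenerator`).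
HONEST LABEL.  Symplectic ∕ hermitian linear algebra over `E ⊗ F_v`; count-neutral helper; `HC_CM` is proved only modulo the 7 printed citations (2 remaining named inputs:
hLiu418 = `stmt-HodgeConjecture-24832`, h413 = `stmt-HodgeConjecture-24833`) until rung 0 closes.

## References
* [MoeglinVignerasWaldspurger1987] C. Mœglin, M.-F. Vignéras, J.-L. Waldspurger, LNM 1291 (1987), Chap. 2 II.2, II.6; Chap. 3 §IV.
* [Rangarao1993] R. Ranga Rao, Pacific J. Math. 157 (1993), Lemma 3.2 (3.8) p. 351; [HarrisKudlaSweet1996] M. Harris, S. S. Kudla, W. J. Sweet, JAMS 9 (1996), §1 (1.11).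
* [KudlaRallis1994] S. Kudla, S. Rallis, Ann. of Math. 140 (1994), §2.
* [Omeara1963] O. T. O'Meara, *Introduction to Quadratic Forms* (1963), §63B (63:10), §63C (63:18).
* [Jacobson1940HermitianForms] N. Jacobson, *A note on hermitian forms*, Bull. AMS 46 (1940), §3 (1)(a).
-/

set_option autoImplicit false
set_option linter.dupNamespace false -- the mandated namespace repeats `HodgeConjecture.HodgeConjecture`

noncomputable section

open NumberField IsDedekindDomain MeasureTheory Matrix
open scoped Pointwise
open Literature.RepresentationTheory.HeisenbergGroup Literature.RepresentationTheory.HeisenbergGroup.SymplecticMatrix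
open Literature.NumberTheory.Automorphic Literature.NumberTheory.Automorphic.UnitaryGroup Literature.NumberTheory.Weil1964
open Literature.NumberTheory.Automorphic.UnitaryGroup.QuadraticCoordinates
open Literature.NumberTheory.GelbartRogawski1991.AdaptedBlocks
open Literature.NumberTheory.GaloisRepresentations.IsNonarchimedeanLocalField
open Literature.NumberTheory.QuadraticForms
open Literature.NumberTheory.GelbartRogawski1991.UnitaryDualPair Literature.NumberTheory.GelbartRogawski1991.UnitaryDualPair.LocalSplitting

namespace Summit.HodgeConjecture.HodgeConjecture.Cruxes.HLiu418.K2LiuIncoherentRankOneBadPlaceDichotomy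

/-! ## §1 Any rank: the phase form is `(im τ) · re h_{𝕋₀}` through the `Δ⁻`-coordinate `b`, and `b` is onto -/

section AnyRank

variable (F : Type) [Field F] [NumberField F] (E : Type) [Field E] [NumberField E] [Algebra F E]
  [Algebra.IsQuadraticExtension F E] (c : E ≃ₐ[F] E)
  {δ : E} (hcδ : c δ = -δ) (hδ : δ ≠ 0) {d : F} (hd : δ * δ = algebraMap F E d)
  (v : HeightOneSpectrum (𝓞 F)) (n : ℕ) {T₀ : Matrix (Fin n) (Fin n) F} (hT₀ : T₀.IsSymm)
  {JD : Matrix (Fin (n + n)) (Fin (n + n)) E} (hJD : JD = (gramD F n T₀).map (algebraMap F E))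

include hT₀ hJD in
/-- **THE PHASE FORM IS `(im τ) · re h_{𝕋₀}(b, b)`**: for the Rao parameter `c = cOfFix 𝕋 (E′ ι(n(τ·1)) E′⁻¹)` of the scalar Siegel unipotent `n(τ · 1)`
(`τ` skew), ANY `E′ ∈ Sp(𝕎_v)` and `x ∈ F_v^{n+n}`, `halfForm (c ·) x = im τ · re h_{𝕋₀}(b, b)` with `b = halfDiff (eD⁻¹ (E′⁻¹ (x, 0)))`
(★ `dotProduct_cOfFix_mover_conj_eq_im` + ★ `im_two_mul_skew_mul_fixed`, halved). [cite: Rangarao1993, Lemma 3.2 (3.8) p. 351]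
[cite: MoeglinVignerasWaldspurger1987, Chap. 2 II.2] -/
theorem halfForm_cOfFix_mover_conj_nElem_eq (τ : LocalRing E v) (hτ : conjLocal E c v τ = -τ)
    (E' : LocalSp F (n + n) (gramD F n T₀) v) (x : Fin (n + n) → v.adicCompletion F) :
    halfForm (Matrix.mulVecLin (cOfFix (localGram F (n + n) (gramD F n T₀) v)
      (E' * iotaD F E c hcδ hδ hd v n hT₀ hJD (nElem F E c v n hJD (τ • 1) (skew_smul_one F E c v n τ hτ)) * E'⁻¹))) x =
      im (quadraticLocalEquiv E v c hcδ hδ).toLinearEquiv.toAddEquiv τ *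
        re (quadraticLocalEquiv E v c hcδ hδ).toLinearEquiv.toAddEquiv
          (UnitaryGroup.hermForm (conjLocal E c v) (gramS F E v n T₀)
            (halfDiff ((eD F E c hcδ hδ hd v n).symm (toLin F v E'⁻¹ (x, 0))))
            (halfDiff ((eD F E c hcδ hδ hd v n).symm (toLin F v E'⁻¹ (x, 0))))) := by
  rw [halfForm, dotProductBilin_apply_apply, Matrix.mulVecLin_apply,
    dotProduct_cOfFix_mover_conj_eq_im F E c hcδ hδ hd v n hT₀ hJD _ τ (adapt_matA_nElem F E c v n hJD _ _) E' x,
    im_two_mul_skew_mul_fixed F E c hcδ hδ hd v (conjLocal_hermForm_gramS_self F E c hcδ hδ hd v n hT₀ _), ← mul_assoc,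
    invOf_mul_self', one_mul]

/-- **`x ↦ b = halfDiff (eD⁻¹ (E′⁻¹ (x, 0)))` IS ONTO `(E ⊗ F_v)^n`** for a mover `E′` (`E′ ℓ_Δ = ℓ_Y`): with `E′ (eD (adblV b₀)) = (x, y)`, `E′⁻¹ (0, y) ∈ ℓ_Δ` has
`halfDiff = 0` and `b(x) = halfDiff (adblV b₀) = b₀`. [cite: MoeglinVignerasWaldspurger1987, Chap. 2 II.2] [cite: HarrisKudlaSweet1996, §1 (1.11)] -/
theorem exists_halfDiff_eq (E' : LocalSp F (n + n) (gramD F n T₀) v)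
    (hE' : (deltaLagrangian F v n).map (toLin F v E') = lagrangianY F (n + n) v) (b₀ : Fin n → LocalRing E v) :
    ∃ x : Fin (n + n) → v.adicCompletion F, halfDiff ((eD F E c hcδ hδ hd v n).symm (toLin F v E'⁻¹ (x, 0))) = b₀ := by
  set p := toLin F v E' (eD F E c hcδ hδ hd v n (adblV b₀)) with hp
  refine ⟨p.1, ?_⟩
  -- `(0, p.2) ∈ ℓ_Y = E′ ℓ_Δ`, so `E′⁻¹ (0, p.2) = eD u` with `u ∈ Δ`
  have hy : ((0 : Fin (n + n) → v.adicCompletion F), p.2) ∈ lagrangianY F (n + n) v :=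
    Submodule.mem_prod.2 ⟨(Submodule.mem_bot _).2 rfl, Submodule.mem_top⟩
  rw [← hE'] at hy
  obtain ⟨z, hz, hzy⟩ := hy
  rw [← map_eD_deltaV F E c hcδ hδ hd v n] at hz
  obtain ⟨u, hu, rfl⟩ := hz
  obtain ⟨a, rfl⟩ := (mem_deltaV_iff_exists F E v n _).1 hu
  -- `E′⁻¹ (p.1, 0) = eD (adblV b₀) - eD (dblV a)`
  have hsplit : ((p.1, (0 : Fin (n + n) → v.adicCompletion F)) : (Fin (n + n) → v.adicCompletion F) × (Fin (n + n) → v.adicCompletion F)) =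
      p + -((0 : Fin (n + n) → v.adicCompletion F), p.2) := by
    ext <;> simp
  have hinv : toLin F v E'⁻¹ p = eD F E c hcδ hδ hd v n (adblV b₀) := by
    rw [hp]
    simp only [LinearEquiv.coe_coe, Subgroup.coe_inv, LinearEquiv.coe_inv, LinearEquiv.symm_apply_apply]
  have hinv' : toLin F v E'⁻¹ ((0 : Fin (n + n) → v.adicCompletion F), p.2) = eD F E c hcδ hδ hd v n (dblV a) := by
    rw [← hzy]
    simp only [LinearEquiv.coe_coe, Subgroup.coe_inv, LinearEquiv.coe_inv, LinearEquiv.symm_apply_apply]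
  rw [hsplit, map_add, map_neg, hinv, hinv', ← map_neg, ← map_add, LinearEquiv.symm_apply_apply,
    show -dblV a = dblV (-a) from by rw [← neg_one_smul (LocalRing E v) (dblV a), ← dblV_smul, neg_one_smul],
    halfDiff_add, halfDiff_adblV, halfDiff_dblV, add_zero]

include hT₀ hJD in
/-- **every value `im τ · re h_{𝕋₀}(b₀, b₀)` is a value of the phase form** (§1's two lemmas). [cite: MoeglinVignerasWaldspurger1987, Chap. 2 II.2] -/
theorem exists_halfForm_cOfFix_mover_conj_nElem_eq_of_hermForm (τ : LocalRing E v) (hτ : conjLocal E c v τ = -τ)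
    (E' : LocalSp F (n + n) (gramD F n T₀) v) (hE' : (deltaLagrangian F v n).map (toLin F v E') = lagrangianY F (n + n) v)
    (b₀ : Fin n → LocalRing E v) :
    ∃ x : Fin (n + n) → v.adicCompletion F,
      halfForm (Matrix.mulVecLin (cOfFix (localGram F (n + n) (gramD F n T₀) v)
        (E' * iotaD F E c hcδ hδ hd v n hT₀ hJD (nElem F E c v n hJD (τ • 1) (skew_smul_one F E c v n τ hτ)) * E'⁻¹))) x =
      im (quadraticLocalEquiv E v c hcδ hδ).toLinearEquiv.toAddEquiv τ *
        re (quadraticLocalEquiv E v c hcδ hδ).toLinearEquiv.toAddEquiv (UnitaryGroup.hermForm (conjLocal E c v) (gramS F E v n T₀) b₀ b₀) := by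
  obtain ⟨x, hx⟩ := exists_halfDiff_eq F E c hcδ hδ hd v n E' hE' b₀
  exact ⟨x, by rw [halfForm_cOfFix_mover_conj_nElem_eq F E c hcδ hδ hd v n hT₀ hJD τ hτ E' x, hx]⟩

end AnyRank

/-! ## §2 Rank `2 + 2` (the datum of record of ★ W1-fin-b ∕ ★ W1-fin §2), `v` non-split: the phase form is UNIVERSAL — recorded negative for `hΨ` -/

section RankTwo

variable (F : Type) [Field F] [NumberField F] (E : Type) [Field E] [NumberField E] [Algebra F E]
  [Algebra.IsQuadraticExtension F E] (c : E ≃ₐ[F] E)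
  {δ : E} (hcδ : c δ = -δ) (hδ : δ ≠ 0) {d : F} (hd : δ * δ = algebraMap F E d)
  (v : HeightOneSpectrum (𝓞 F)) {T₀ : Matrix (Fin 2) (Fin 2) F} (hT₀ : T₀.IsSymm) (hT₀d : IsUnit T₀.det)
  {JD : Matrix (Fin (2 + 2)) (Fin (2 + 2)) E} (hJD : JD = (gramD F 2 T₀).map (algebraMap F E))

include hT₀ hT₀d hd in
/-- a non-degenerate binary hermitian form with coefficients `𝕋₀ = T₀ ⊗ 1` REPRESENTS every element of `F_v` at a non-split place:
`re h_{𝕋₀}(x, x) = β″` for some `x ∈ E_v²` (Jacobson: ★ `exists_hermForm_self_eq_one` applied to `ι_v(β″⁻¹) · 𝕋₀`; `β″ = 0` at `x = 0`).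
[cite: Jacobson1940HermitianForms, §3 (1)(a)] [cite: Omeara1963, §63C (63:18)] -/
theorem exists_re_hermForm_gramS_self_eq (w : PlacesOver E v) (hw : c • w.1 = w.1) (β'' : v.adicCompletion F) :
    ∃ x : Fin 2 → LocalRing E v,
      re (quadraticLocalEquiv E v c hcδ hδ).toLinearEquiv.toAddEquiv (UnitaryGroup.hermForm (conjLocal E c v) (gramS F E v 2 T₀) x x) = β'' := by
  have hq := isQuadraticCoordinates_local E v c hcδ hδ hd
  by_cases hβ : β'' = 0
  · refine ⟨0, ?_⟩
    rw [hβ, UnitaryGroup.hermForm, Matrix.mulVec_zero, dotProduct_zero, map_zero]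
  -- scale the Gram matrix by `ι_v(β″⁻¹)`
  set s : LocalRing E v := toLocalRing E v β''⁻¹ with hs
  have hsu : IsUnit s := (isUnit_iff_ne_zero.2 (inv_ne_zero hβ)).map (toLocalRing E v)
  have h1 : (s • gramS F E v 2 T₀).map (conjLocal E c v) = s • (gramS F E v 2 T₀).map (conjLocal E c v) := by
    ext i j
    simp only [Matrix.map_apply, Matrix.smul_apply, smul_eq_mul, map_mul, hs, conjLocal_toLocalRing]
  have hG' : ((s • gramS F E v 2 T₀).map (conjLocal E c v))ᵀ = s • gramS F E v 2 T₀ := by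
    rw [h1, gramS_map_conj F E c v 2 (T₀ := T₀), Matrix.transpose_smul, gramS_transpose F E v 2 hT₀]
  have hG'd : IsUnit (s • gramS F E v 2 T₀).det := by
    rw [Matrix.det_smul]
    exact (hsu.pow _).mul (isUnit_det_gramS' F E v 2 hT₀d)
  obtain ⟨x, hx⟩ := exists_hermForm_self_eq_one E v c hcδ hδ w hw hG' hG'd
  refine ⟨x, ?_⟩
  have hx' : UnitaryGroup.hermForm (conjLocal E c v) (gramS F E v 2 T₀) x x = toLocalRing E v β'' := by
    have hsc : UnitaryGroup.hermForm (conjLocal E c v) (s • gramS F E v 2 T₀) x x =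
        s * UnitaryGroup.hermForm (conjLocal E c v) (gramS F E v 2 T₀) x x := by
      rw [UnitaryGroup.hermForm, UnitaryGroup.hermForm, Matrix.smul_mulVec, dotProduct_smul, smul_eq_mul]
    rw [hsc, hs] at hx
    calc UnitaryGroup.hermForm (conjLocal E c v) (gramS F E v 2 T₀) x x
        = toLocalRing E v β'' * (toLocalRing E v β''⁻¹ * UnitaryGroup.hermForm (conjLocal E c v) (gramS F E v 2 T₀) x x) := by
          rw [← mul_assoc, ← map_mul, mul_inv_cancel₀ hβ, map_one, one_mul]
      _ = toLocalRing E v β'' := by rw [hx, mul_one]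
  rw [hx', hq.re_map]

include hT₀d in
/-- **RANK `2 + 2`, NON-SPLIT `v`: THE PHASE FORM IS UNIVERSAL** — for the datum of record of ★ W1-fin-b ∕ ★ W1-fin §2 (`V = T₀ ⊗ 1` a hermitian PLANE,
`U(V ⊕ −V) = U(2,2)`, `𝒮(F_v^{2+2})`), any mover `E′`, any non-zero skew `τ`, EVERY `β′ ∈ F_v` is a value of `halfForm (cOfFix 𝕋 (E′ ι(n(τ·1)) E′⁻¹))`: the fibre is
never empty, so `hΨ` is NOT a consequence of «`v` dead» at this rank. [cite: Omeara1963, §63C (63:18)] [cite: MoeglinVignerasWaldspurger1987, Chap. 2 II.6] -/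
theorem exists_halfForm_cOfFix_mover_conj_nElem_eq (w : PlacesOver E v) (hw : c • w.1 = w.1)
    (τ : LocalRing E v) (hτ : conjLocal E c v τ = -τ) (hτ0 : τ ≠ 0)
    (E' : LocalSp F (2 + 2) (gramD F 2 T₀) v) (hE' : (deltaLagrangian F v 2).map (toLin F v E') = lagrangianY F (2 + 2) v)
    (β' : v.adicCompletion F) :
    ∃ x : Fin (2 + 2) → v.adicCompletion F,
      halfForm (Matrix.mulVecLin (cOfFix (localGram F (2 + 2) (gramD F 2 T₀) v)
        (E' * iotaD F E c hcδ hδ hd v 2 hT₀ hJD (nElem F E c v 2 hJD (τ • 1) (skew_smul_one F E c v 2 τ hτ)) * E'⁻¹))) x = β' := by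
  have him : im (quadraticLocalEquiv E v c hcδ hδ).toLinearEquiv.toAddEquiv τ ≠ 0 := im_ne_zero_of_conjLocal_eq_neg F E c hcδ hδ hd v hτ hτ0
  obtain ⟨b₀, hb₀⟩ := exists_re_hermForm_gramS_self_eq F E c hcδ hδ hd v hT₀ hT₀d w hw
    (β' * (im (quadraticLocalEquiv E v c hcδ hδ).toLinearEquiv.toAddEquiv τ)⁻¹)
  obtain ⟨x, hx⟩ := exists_halfForm_cOfFix_mover_conj_nElem_eq_of_hermForm F E c hcδ hδ hd v 2 hT₀ hJD τ hτ E' hE' b₀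
  exact ⟨x, by rw [hx, hb₀, mul_comm, inv_mul_cancel_right₀ him]⟩

include hT₀d in
/-- **RECORDED NEGATIVE — at rank `2 + 2` SOME TEST VECTOR VIOLATES THE SUPPORT DICHOTOMY, for every `β′` and every implementer `Γ`**: `Ψ = Γ⁻¹ 1_{y₀ + 𝒪_v^{2+2}}`
with `halfForm (c ·) y₀ = β′` has `y₀ ∈ tsupport (Γ Ψ)`; so ★ W1-fin's `hΨ` is a property of the SPECIFIC `Ψ`, not of the place. [cite: Omeara1963, §63C (63:18)]
[cite: KudlaRallis1994, §2] -/
theorem exists_testVector_not_supportDichotomy (w : PlacesOver E v) (hw : c • w.1 = w.1)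
    (τ : LocalRing E v) (hτ : conjLocal E c v τ = -τ) (hτ0 : τ ≠ 0)
    (E' : LocalSp F (2 + 2) (gramD F 2 T₀) v) (hE' : (deltaLagrangian F v 2).map (toLin F v E') = lagrangianY F (2 + 2) v)
    (Γ : SchwartzBruhat (Fin (2 + 2) → v.adicCompletion F) ≃ₗ[ℂ] SchwartzBruhat (Fin (2 + 2) → v.adicCompletion F))
    (β' : v.adicCompletion F) :
    ∃ Ψ : SchwartzBruhat (Fin (2 + 2) → v.adicCompletion F),
      ∃ y ∈ tsupport (((Γ Ψ : SchwartzBruhat (Fin (2 + 2) → v.adicCompletion F))) : (Fin (2 + 2) → v.adicCompletion F) → ℂ),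
        halfForm (Matrix.mulVecLin (cOfFix (localGram F (2 + 2) (gramD F 2 T₀) v)
          (E' * iotaD F E c hcδ hδ hd v 2 hT₀ hJD (nElem F E c v 2 hJD (τ • 1) (skew_smul_one F E c v 2 τ hτ)) * E'⁻¹))) y = β' := by
  obtain ⟨y₀, hy₀⟩ := exists_halfForm_cOfFix_mover_conj_nElem_eq F E c hcδ hδ hd v hT₀ hT₀d hJD w hw τ hτ hτ0 E' hE' β'
  refine ⟨Γ.symm ⟨(y₀ +ᵥ piPrimePowBall (v.adicCompletion F) (Fin (2 + 2)) 0).indicator fun _ => (1 : ℂ),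
    indicator_vadd_piPrimePowBall_mem_schwartzBruhat 0 y₀ 1⟩, y₀, ?_, hy₀⟩
  rw [LinearEquiv.apply_symm_apply]
  refine subset_tsupport _ (Function.mem_support.2 ?_)
  change (y₀ +ᵥ piPrimePowBall (v.adicCompletion F) (Fin (2 + 2)) 0).indicator (fun _ => (1 : ℂ)) y₀ ≠ 0
  rw [Set.indicator_of_mem (Set.mem_vadd_set.2 ⟨0, zero_mem_piPrimePowBall 0, add_zero y₀⟩)]
  exact one_ne_zero

end RankTwo

/-! ## §3 Rank `1 + 1` (the complementary LINE `⟨a⟩`, `U(⟨a⟩ ⊕ ⟨−a⟩)`, `𝒮(F_v^{1+1})`): the phase form is the binary NORM form — the Ψ-free dichotomy -/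

section RankOne

variable (F : Type) [Field F] [NumberField F] (E : Type) [Field E] [NumberField E] [Algebra F E]
  [Algebra.IsQuadraticExtension F E] (c : E ≃ₐ[F] E)
  {δ : E} (hcδ : c δ = -δ) (hδ : δ ≠ 0) {d : F} (hd : δ * δ = algebraMap F E d)
  (v : HeightOneSpectrum (𝓞 F)) {T₀ : Matrix (Fin 1) (Fin 1) F} (hT₀ : T₀.IsSymm)
  {JD : Matrix (Fin (1 + 1)) (Fin (1 + 1)) E} (hJD : JD = (gramD F 1 T₀).map (algebraMap F E))

include hT₀ hJD in
/-- **RANK `1 + 1`: THE PHASE FORM IS THE BINARY NORM FORM `im τ · a · (re b₀² − d · im b₀²)`** (`T₀ = (a)`, `b₀ = b 0`, `b = halfDiff (eD⁻¹ (E′⁻¹ (x, 0)))`;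
§1 + `h_{(a)}(b, b) = ι_v(a) · b₀ b̄₀` + the multiplication rule of the quadratic coordinates). [cite: KudlaRallis1994, §2]
[cite: Rangarao1993, Lemma 3.2 (3.8) p. 351] -/
theorem halfForm_cOfFix_mover_conj_nElem_eq_norm_one (τ : LocalRing E v) (hτ : conjLocal E c v τ = -τ)
    (E' : LocalSp F (1 + 1) (gramD F 1 T₀) v) (x : Fin (1 + 1) → v.adicCompletion F) :
    halfForm (Matrix.mulVecLin (cOfFix (localGram F (1 + 1) (gramD F 1 T₀) v)
      (E' * iotaD F E c hcδ hδ hd v 1 hT₀ hJD (nElem F E c v 1 hJD (τ • 1) (skew_smul_one F E c v 1 τ hτ)) * E'⁻¹))) x =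
      im (quadraticLocalEquiv E v c hcδ hδ).toLinearEquiv.toAddEquiv τ *
        (algebraMap F (v.adicCompletion F) (T₀ 0 0) *
          (re (quadraticLocalEquiv E v c hcδ hδ).toLinearEquiv.toAddEquiv (halfDiff ((eD F E c hcδ hδ hd v 1).symm (toLin F v E'⁻¹ (x, 0))) 0) ^ 2 -
            (d : v.adicCompletion F) *
              im (quadraticLocalEquiv E v c hcδ hδ).toLinearEquiv.toAddEquiv (halfDiff ((eD F E c hcδ hδ hd v 1).symm (toLin F v E'⁻¹ (x, 0))) 0) ^ 2)) := by
  have hq := isQuadraticCoordinates_local E v c hcδ hδ hd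
  have hσδ : conjLocal E c v (algebraMap E (LocalRing E v) δ) = -algebraMap E (LocalRing E v) δ := by
    rw [conjLocal_algebraMap, hcδ, map_neg]
  rw [halfForm_cOfFix_mover_conj_nElem_eq F E c hcδ hδ hd v 1 hT₀ hJD τ hτ E' x]
  congr 1
  set b := halfDiff ((eD F E c hcδ hδ hd v 1).symm (toLin F v E'⁻¹ (x, 0))) with hb
  have hherm : UnitaryGroup.hermForm (conjLocal E c v) (gramS F E v 1 T₀) b b =
      toLocalRing E v (algebraMap F (v.adicCompletion F) (T₀ 0 0)) * (b 0 * conjLocal E c v (b 0)) := by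
    simp only [UnitaryGroup.hermForm, dotProduct, Matrix.mulVec, Fin.sum_univ_one, Function.comp_apply, Matrix.map_apply]
    ring
  rw [hherm, hq.re_map_mul, hq.re_mul, hq.re_conj (conjLocal_toLocalRing c v) hσδ, hq.im_conj (conjLocal_toLocalRing c v) hσδ]
  ring

include hT₀ hJD in
/-- **THE Ψ-FREE SUPPORT DICHOTOMY AT RANK `1 + 1` (norm-class form)**: `β′ ≠ 0` and `β′ · (a · im τ)⁻¹` NOT of the form `r² − d s²` ⟹
`halfForm (cOfFix 𝕋 (E′ ι(n(τ·1)) E′⁻¹)) x ≠ β′` for EVERY `x ∈ F_v^{1+1}` (hence on `tsupport (Γ Ψ)` for every `Ψ`). [cite: KudlaRallis1994, §2] [cite: Omeara1963, §63B (63:10)] -/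
theorem halfForm_cOfFix_mover_conj_nElem_ne_of_not_norm (τ : LocalRing E v) (hτ : conjLocal E c v τ = -τ)
    (E' : LocalSp F (1 + 1) (gramD F 1 T₀) v) (β' : v.adicCompletion F) (hβ : β' ≠ 0)
    (hN : ¬ ∃ r s : v.adicCompletion F, r ^ 2 - (d : v.adicCompletion F) * s ^ 2 =
      β' * (algebraMap F (v.adicCompletion F) (T₀ 0 0) * im (quadraticLocalEquiv E v c hcδ hδ).toLinearEquiv.toAddEquiv τ)⁻¹) :
    ∀ x : Fin (1 + 1) → v.adicCompletion F,
      halfForm (Matrix.mulVecLin (cOfFix (localGram F (1 + 1) (gramD F 1 T₀) v)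
        (E' * iotaD F E c hcδ hδ hd v 1 hT₀ hJD (nElem F E c v 1 hJD (τ • 1) (skew_smul_one F E c v 1 τ hτ)) * E'⁻¹))) x ≠ β' := by
  intro x hx
  rw [halfForm_cOfFix_mover_conj_nElem_eq_norm_one F E c hcδ hδ hd v hT₀ hJD τ hτ E' x] at hx
  set t := algebraMap F (v.adicCompletion F) (T₀ 0 0) * im (quadraticLocalEquiv E v c hcδ hδ).toLinearEquiv.toAddEquiv τ with ht
  set N := re (quadraticLocalEquiv E v c hcδ hδ).toLinearEquiv.toAddEquiv (halfDiff ((eD F E c hcδ hδ hd v 1).symm (toLin F v E'⁻¹ (x, 0))) 0) ^ 2 -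
      (d : v.adicCompletion F) *
        im (quadraticLocalEquiv E v c hcδ hδ).toLinearEquiv.toAddEquiv (halfDiff ((eD F E c hcδ hδ hd v 1).symm (toLin F v E'⁻¹ (x, 0))) 0) ^ 2 with hN'
  have hx' : t * N = β' := by rw [← hx, ht]; ring
  by_cases h0 : t = 0
  · exact hβ (by rw [← hx', h0, zero_mul])
  · exact hN ⟨_, _, by rw [← hN', ← hx', mul_comm t N, mul_inv_cancel_right₀ h0]⟩

include hT₀ hJD hd hδ in
/-- **THE Ψ-FREE SUPPORT DICHOTOMY AT RANK `1 + 1` (Hilbert-symbol form)**: `β′ ≠ 0` and `(β′ · (a · im τ)⁻¹, d)_v = −1` ⟹ `halfForm (c ·) x ≠ β′` for every `x`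
(O'Meara 63:10, ★ `hilbertSymbol_eq_one_iff_exists_norm`) — the `hΨ` letter a `(1+1)` edition of ★ W1-fin §2 consumes FOR EVERY `Ψ` («the complementary line does not
represent the Whittaker parameter»). [cite: Omeara1963, §63B (63:10)] [cite: KudlaRallis1994, §2] -/
theorem halfForm_cOfFix_mover_conj_nElem_ne_of_hilbertSymbol (τ : LocalRing E v) (hτ : conjLocal E c v τ = -τ)
    (E' : LocalSp F (1 + 1) (gramD F 1 T₀) v) (β' : v.adicCompletion F) (hβ : β' ≠ 0)
    (hclass : hilbertSymbol (v.adicCompletion F)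
      (β' * (algebraMap F (v.adicCompletion F) (T₀ 0 0) * im (quadraticLocalEquiv E v c hcδ hδ).toLinearEquiv.toAddEquiv τ)⁻¹)
      (d : v.adicCompletion F) = -1) :
    ∀ x : Fin (1 + 1) → v.adicCompletion F,
      halfForm (Matrix.mulVecLin (cOfFix (localGram F (1 + 1) (gramD F 1 T₀) v)
        (E' * iotaD F E c hcδ hδ hd v 1 hT₀ hJD (nElem F E c v 1 hJD (τ • 1) (skew_smul_one F E c v 1 τ hτ)) * E'⁻¹))) x ≠ β' := by
  haveI : CharZero (v.adicCompletion F) := charZero_of_injective_algebraMap (algebraMap F (v.adicCompletion F)).injective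
  haveI : NeZero (2 : v.adicCompletion F) := ⟨two_ne_zero⟩
  have hd0 : (d : v.adicCompletion F) ≠ 0 := by
    refine (map_ne_zero (algebraMap F (v.adicCompletion F))).2 fun h => hδ ?_
    have h2 : δ * δ = 0 := by rw [hd, h, map_zero]
    exact mul_self_eq_zero.1 h2
  set t := algebraMap F (v.adicCompletion F) (T₀ 0 0) * im (quadraticLocalEquiv E v c hcδ hδ).toLinearEquiv.toAddEquiv τ with ht
  by_cases h0 : t = 0
  · -- degenerate parameter: the phase form vanishes identically and `β′ ≠ 0`
    intro x hx
    rw [halfForm_cOfFix_mover_conj_nElem_eq_norm_one F E c hcδ hδ hd v hT₀ hJD τ hτ E' x] at hx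
    apply hβ
    rw [← hx]
    have : im (quadraticLocalEquiv E v c hcδ hδ).toLinearEquiv.toAddEquiv τ * algebraMap F (v.adicCompletion F) (T₀ 0 0) = 0 := by
      rw [mul_comm]; exact h0
    rw [← mul_assoc, this, zero_mul]
  · refine halfForm_cOfFix_mover_conj_nElem_ne_of_not_norm F E c hcδ hδ hd v hT₀ hJD τ hτ E' β' hβ fun hex => ?_
    have hu : β' * t⁻¹ ≠ 0 := mul_ne_zero hβ (inv_ne_zero h0)
    have h1 : hilbertSymbol (v.adicCompletion F) (d : v.adicCompletion F) (β' * t⁻¹) = 1 :=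
      (hilbertSymbol_eq_one_iff_exists_norm hd0 hu).2 hex
    rw [hilbertSymbol_comm, hclass] at h1
    norm_num at h1

end RankOne

/-! ## §4 CM reading (`L` CM, `δ = imagUnit L`, `d = imagUnitSq L`) of the rank-`1 + 1` dichotomy -/

section CM

variable (L : Type) [Field L] [NumberField L] [IsCMField L] (v : HeightOneSpectrum (𝓞 (maximalRealSubfield L)))
  {T : Matrix (Fin 1) (Fin 1) (maximalRealSubfield L)} (hTs : T.IsSymm)

include hTs in
/-- **THE Ψ-FREE SUPPORT DICHOTOMY OF THE LINE, CM TOKENS**: for `L` CM, a finite place `v` of `L⁺`, the line Gram `T = (a) ∈ M_1(L⁺)`, any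
`E″ ∈ Sp(𝕎_v)` of the doubled rank-one datum (`gramD L⁺ 1 T`), a skew `τ ∈ L ⊗ L⁺_v` and `β′ ∈ L⁺_vˣ` with
`(β′ · (a · im τ)⁻¹, δ²)_v = −1` (`δ = imagUnit L`): `halfForm (cOfFix 𝕋 (E″ ι(n(τ·1)) E″⁻¹)) x ≠ β′` for every `x ∈ L⁺_v^{1+1}`.
[cite: Omeara1963, §63B (63:10)] [cite: KudlaRallis1994, §2] -/
theorem halfForm_cOfFix_mover_conj_nElem_ne_of_hilbertSymbol_cm (τ : LocalRing L v) (hτ : conjLocal L (IsCMField.complexConj L) v τ = -τ)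
    (E'' : LocalSp (maximalRealSubfield L) (1 + 1) (gramD (maximalRealSubfield L) 1 T) v)
    (β' : v.adicCompletion (maximalRealSubfield L)) (hβ : β' ≠ 0)
    (hclass : hilbertSymbol (v.adicCompletion (maximalRealSubfield L))
      (β' * (algebraMap (maximalRealSubfield L) (v.adicCompletion (maximalRealSubfield L)) (T 0 0) *
        im (quadraticLocalEquiv L v (IsCMField.complexConj L) (complexConj_imagUnit L) (imagUnit_ne_zero L)).toLinearEquiv.toAddEquiv τ)⁻¹)
      ((imagUnitSq L : maximalRealSubfield L) : v.adicCompletion (maximalRealSubfield L)) = -1) :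
    ∀ x : Fin (1 + 1) → v.adicCompletion (maximalRealSubfield L),
      halfForm (Matrix.mulVecLin (cOfFix (localGram (maximalRealSubfield L) (1 + 1) (gramD (maximalRealSubfield L) 1 T) v)
        (E'' * iotaD (maximalRealSubfield L) L (IsCMField.complexConj L) (complexConj_imagUnit L) (imagUnit_ne_zero L) (imagUnit_mul_self L) v 1 hTs rfl
          (nElem (maximalRealSubfield L) L (IsCMField.complexConj L) v 1 rfl (τ • 1)
            (skew_smul_one (maximalRealSubfield L) L (IsCMField.complexConj L) v 1 τ hτ)) * E''⁻¹))) x ≠ β' :=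
  halfForm_cOfFix_mover_conj_nElem_ne_of_hilbertSymbol (maximalRealSubfield L) L (IsCMField.complexConj L) (complexConj_imagUnit L)
    (imagUnit_ne_zero L) (imagUnit_mul_self L) v hTs rfl τ hτ E'' β' hβ hclass

/-- **square classes: `δ² = θ · r²`** for the apparatus' `δ = imagUnit L` and the dead-place test's `θ = cmQuadraticGenerator L` (`θ = α²`, `α` and `δ` both
non-zero purely imaginary, so `r = δ ∕ α ∈ L⁺ˣ`). [folklore] -/
theorem exists_imagUnitSq_eq_cmQuadraticGenerator_mul_sq :
    ∃ r : maximalRealSubfield L, r ≠ 0 ∧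
      (imagUnitSq L : maximalRealSubfield L) = (cmQuadraticGenerator L : maximalRealSubfield L) * r ^ 2 := by
  obtain ⟨α, hα0, hαc, hαsq⟩ := cmQuadraticGenerator_spec L
  have hmem : imagUnit L / α ∈ maximalRealSubfield L := by
    rw [← IsCMField.complexConj_eq_self_iff, map_div₀, complexConj_imagUnit, hαc, neg_div_neg_eq]
  refine ⟨⟨imagUnit L / α, hmem⟩, fun h => div_ne_zero (imagUnit_ne_zero L) hα0 (congrArg Subtype.val h), ?_⟩
  apply Subtype.ext
  have hθ : ((cmQuadraticGenerator L : maximalRealSubfield L) : L) = α ^ 2 := by rw [hαsq]; rfl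
  rw [show ((imagUnitSq L : maximalRealSubfield L) : L) = imagUnit L * imagUnit L from (imagUnit_mul_self L).symm]
  push_cast
  rw [hθ]
  field_simp

/-- **the Hilbert symbols against `δ²` and against `θ` agree**: `(u, δ²)_v = (u, θ)_v` (★ `hilbertSymbol_mul_sq_right`). [cite: Omeara1963, §63B] -/
theorem hilbertSymbol_imagUnitSq_eq_cmQuadraticGenerator (u : v.adicCompletion (maximalRealSubfield L)) :
    hilbertSymbol (v.adicCompletion (maximalRealSubfield L)) u ((imagUnitSq L : maximalRealSubfield L) : v.adicCompletion (maximalRealSubfield L)) =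
      hilbertSymbol (v.adicCompletion (maximalRealSubfield L)) u
        (algebraMap (maximalRealSubfield L) (v.adicCompletion (maximalRealSubfield L)) (cmQuadraticGenerator L : maximalRealSubfield L)) := by
  obtain ⟨r, hr0, hr⟩ := exists_imagUnitSq_eq_cmQuadraticGenerator_mul_sq L
  have hr0' : algebraMap (maximalRealSubfield L) (v.adicCompletion (maximalRealSubfield L)) r ≠ 0 := (map_ne_zero _).2 hr0
  rw [show ((imagUnitSq L : maximalRealSubfield L) : v.adicCompletion (maximalRealSubfield L)) =
      algebraMap (maximalRealSubfield L) _ (imagUnitSq L) from rfl, hr, map_mul, map_pow, hilbertSymbol_mul_sq_right _ _ hr0']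

include hTs in
/-- **THE Ψ-FREE SUPPORT DICHOTOMY OF THE LINE IN THE DEAD-PLACE TEST'S CURRENCY** (`θ = cmQuadraticGenerator L`, as in the `hΨ` ∕ `hV` binders of ★ p863462 ∕
★ p863521 ∕ ★ p862742: `hilbertSymbol L⁺_v (·) (algebraMap θ)`): `β′ ≠ 0` and `(β′ · (a · im τ)⁻¹, θ)_v = −1` ⟹ `halfForm (cOfFix 𝕋 (E″ ι(n(τ·1)) E″⁻¹)) x ≠ β′`
for every `x ∈ L⁺_v^{1+1}`. [cite: Omeara1963, §63B (63:10)] [cite: KudlaRallis1994, §2] -/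
theorem halfForm_cOfFix_mover_conj_nElem_ne_of_hilbertSymbol_cmQuadraticGenerator (τ : LocalRing L v)
    (hτ : conjLocal L (IsCMField.complexConj L) v τ = -τ)
    (E'' : LocalSp (maximalRealSubfield L) (1 + 1) (gramD (maximalRealSubfield L) 1 T) v)
    (β' : v.adicCompletion (maximalRealSubfield L)) (hβ : β' ≠ 0)
    (hclass : hilbertSymbol (v.adicCompletion (maximalRealSubfield L))
      (β' * (algebraMap (maximalRealSubfield L) (v.adicCompletion (maximalRealSubfield L)) (T 0 0) *
        im (quadraticLocalEquiv L v (IsCMField.complexConj L) (complexConj_imagUnit L) (imagUnit_ne_zero L)).toLinearEquiv.toAddEquiv τ)⁻¹)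
      (algebraMap (maximalRealSubfield L) (v.adicCompletion (maximalRealSubfield L)) (cmQuadraticGenerator L : maximalRealSubfield L)) = -1) :
    ∀ x : Fin (1 + 1) → v.adicCompletion (maximalRealSubfield L),
      halfForm (Matrix.mulVecLin (cOfFix (localGram (maximalRealSubfield L) (1 + 1) (gramD (maximalRealSubfield L) 1 T) v)
        (E'' * iotaD (maximalRealSubfield L) L (IsCMField.complexConj L) (complexConj_imagUnit L) (imagUnit_ne_zero L) (imagUnit_mul_self L) v 1 hTs rfl
          (nElem (maximalRealSubfield L) L (IsCMField.complexConj L) v 1 rfl (τ • 1)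
            (skew_smul_one (maximalRealSubfield L) L (IsCMField.complexConj L) v 1 τ hτ)) * E''⁻¹))) x ≠ β' :=
  halfForm_cOfFix_mover_conj_nElem_ne_of_hilbertSymbol_cm L v hTs τ hτ E'' β' hβ
    (by rw [hilbertSymbol_imagUnitSq_eq_cmQuadraticGenerator]; exact hclass)

end CM

end Summit.HodgeConjecture.HodgeConjecture.Cruxes.HLiu418.K2LiuIncoherentRankOneBadPlaceDichotomy

end
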